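import Summits.Ventures.QEC.Thresholds.PlanarLossThresholdHalf
import Summits.Ventures.QEC.Thresholds.PlanarSurfaceCodeMWPMThresholds
import Summits.Ventures.QEC.Thresholds.PlanarDepolarizingThreshold
import Summits.Ventures.QEC.Thresholds.ToricCodeThresholdKernelSymmK16
import Summits.Ventures.QEC.Thresholds.ToricCodeExponentialDecay
import Literature.InformationTheory.QuantumCodes.PlanarCodeCrossingPathsBound
import HarnessLib

/-!
# Planar surface codes, code capacity: the SAW-counting threshold `p₀(μ) > .0357` for every minimum-weight / MWPM
# decoder family, both sectors (Dennis–Kitaev–Landahl–Preskill's relative polygons) — unconditional, tier CERTIFIED (kernel)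

Venture QEC, `Summits/Ventures/QEC/Thresholds/` (LADDER-QEC rung Q5, PARTITION row 09; qec-type-09 gen 6, cell item 135
«09.PSAW»). Until now the tree certified the planar surface codes (`planarHX k` / `planarHZ k` = lit-2's `HGP(H, Hᵀ)`,
`(k+2)² + (k+1)²` qubits, one logical qubit) at the CLUSTER-EXPANSION value `p₀(3) = (3-2√2)/6 ≈ .0286`
(`planar_isThresholdLowerBound`, Dumer–Kovalev–Pryadko), while the toric codes stand at the SAW value `p₀(2.6939) > .0357`
(`toricThreshold_kernelSymmK16`). DKLP §5.3: "To bound the failure probability for a planar code rather than the toric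
code, we should count the 'relative polygons' that stretch from one edge of the lattice to the opposite edge. This change has
no effect on the estimate of the threshold." The files `PlanarCodeCrossingPaths.lean` / `PlanarCodeCrossingPathsBound.lean` make
that remark a theorem: a failing minimum-weight correction leaves an odd-crossing residual, which contains a rough-to-rough
self-avoiding path with `n ≥ k + 2` bonds at least half faulty; there are `≤ (k+2)·cₙ` such paths; hence
`Prob ≤ (k+2)·C·r^{k+2}/(1-r)` under `cₙ ≤ C νⁿ`, `r = 2ν√(p(1-p))`. This file packages the consequences in the cell's
vocabulary (`IsThresholdLowerBound` / `thresholdValue` / `accuracyThreshold` / `DecaysExponentially`):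

| theorem | statement | tier |
|---|---|---|
| `planar_bottomCrossing_eq_one`, `planar_oddResidual_of_not_corrects`, `planarFailureFamily_le_of_sawCountBound` | non-trivial logical / failure ⇒ odd bottom crossing (one logical qubit, type-03's `planar_logical_add_string_mem`); DKLP finite-size bound `P_fail(k) ≤ (k+2)·C·r^{k+2}/(1-r)` | CERTIFIED (kernel) |
| `isThresholdLowerBound_thresholdValue_of_forall_gt` | GENERIC: below-threshold for all `4ν²p(1-p) < 1`, all `ν > μ'` ⇒ threshold `≥ p₀(μ')` — any family | — |
| `planar_isThresholdLowerBound_of_sawCountBound`, `…_of_connectiveConstant_le` | `cₙ ≤ C νⁿ ⇒ p_c ≥ p₀(ν)`; `μ(ℤ²) ≤ μ' ⇒ p_c ≥ p₀(μ')` — every minimum-weight decoder family of the `H_X`-sector | CERTIFIED (kernel), parametric |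
| ★ `planar_isThresholdLowerBound_kernelSymmK16`, `planar_isThresholdLowerBound_0357`, `planar_accuracyThreshold_gt_0357`, `planar_accuracyThreshold_minWeight_gt_0357`, `planar_decaysExponentially_0357` | **`p_c(planar) > .0357`** at the kernel certificate `μ(ℤ²) ≤ 2.6939` (was `.0285`), every minimum-weight decoder family; exponential decay for `p ≤ .0357` | CERTIFIED (kernel), unconditional |
| `planar_mwpm_isThresholdLowerBound_kernelSymmK16`, `planar_mwpm_accuracyThreshold_gt_0357`, `exists_planar_mwpm_family_accuracyThreshold_gt_0357` | the same for EVERY boundary-MWPM family (any graphlike presentation, metric, tie-break); non-vacuity | CERTIFIED (kernel), unconditional |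

The SECOND SECTOR (`H_Z`-checks, smooth edges; by the coordinate-swap self-duality `planarHGPCode_swap_eq_reindex` and
decoder pull-back), both sectors at once and the DEPOLARIZING corollary `p_c^depol(planar) > .0535` are the companion file
`PlanarSurfaceCodeSAWThresholdsDual.lean`.

HONEST FRAMING. Certified LOWER bounds; the decimals are kernel-checked consequences of the symmetry-reduced memory-16
automaton certificate `μ(ℤ²) ≤ 2.6939` (`SAW.Zd.connectiveConstant_two_le_26939`). Printed numbers NOT asserted anywhere:
DKLP's `p_c ≥ .0373` (their eq. (p_c_2d), with the numerical ESTIMATE `μ₂ ≈ 2.638`) and the NUMERICAL minimum-weight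
(MWPM) threshold of the surface code `p_{c0} = .1031 ± .0001` (Wang–Harrington–Preskill 2003, abstract and §4) — CLAIMS;
certified `.0357` vs numerical `.1031`, stated with their locators. No `native_decide`, no named fact, axioms standard.

## References

* [DennisEtAl2002] E. Dennis, A. Kitaev, A. Landahl, J. Preskill, *Topological quantum memory*, J. Math. Phys. 43 (2002)
  4452–4505, arXiv:quant-ph/0110143, §3.2 (planar codes), §4.1, §5.2–5.3 (eqs. (e_ineq), (28), (29), (threshold_2d),
  (p_c_2d), (fail_2d); relative polygons: "This change has no effect on the estimate of the threshold").
* [WangHarringtonPreskill2003] C. Wang, J. Harrington, J. Preskill, Ann. Phys. 303 (2003) 31–58, arXiv:quant-ph/0207088,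
  abstract and §4 (`p_{c0} = .1031 ± .0001`, numerical).
* [PonitzTittmann2000] A. Pönitz, P. Tittmann, Electron. J. Combin. 7 (2000) R21, Table 2 (`d = 2`, `k = 16`: `2.6939`).
* [TillichZemor2014] J.-P. Tillich, G. Zémor, IEEE Trans. IT 60 (2014) 1193, §3 and Thm 7 (the surface code, `k = 1`).
* [LinPryadko2024] H.-K. Lin, L. P. Pryadko, Phys. Rev. A 109 (2024) 022407, §4.2 Thm 6 (permutation-equivalent codes).
-/

noncomputable section

namespace Summit.Ventures.QEC.Thresholds

open Filter Topology Finset Matrix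
open Literature.InformationTheory.QuantumCodes
open Literature.InformationTheory.QuantumCodes.PlanarCode
open Literature.InformationTheory.QuantumCodes.ToricCode (SAWCountBound)
open Literature.Probability.RandomPlanarGeometry

/-! ### Failure leaves an odd-crossing residual; the finite-size bound -/

/-- **A non-trivial logical of the `H_X`-sector crosses the bottom rough boundary an odd number of times**: the planar
code encodes one qubit, so an undetectable `x ∉ rs H_Z` is `x̄ +` a stabilizer (`planar_logical_add_string_mem`) and pairs
to `1` with `z̄` (`planarZString_dotProduct`). [cite: TillichZemor2014, §3 and Thm 7 (one logical qubit)]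
[cite: DennisEtAl2002, §3.2 (relative cycles of the planar code)] -/
theorem planar_bottomCrossing_eq_one (k : ℕ) {x : PlanarQubit k → ZMod 2} (hx : planarHX k *ᵥ x = 0)
    (hxS : x ∉ (planarSZ k : Set (PlanarQubit k → ZMod 2))) : ∑ b : Fin (k + 2), x (Sum.inl (0, b)) = 1 := by
  have hcS : x ∉ (planarHGPCode k).rowSpZ := hxS
  rw [← planarZString_dotProduct]
  have hmem := planar_logical_add_string_mem k hx hcS
  have h1 : planarZString k ⬝ᵥ (x + planarXString k) = 0 :=
    dotProduct_eq_zero_of_mem_rowSpace hmem (planarHZ_mulVec_planarZString k)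
  have h2 : planarZString k ⬝ᵥ planarXString k = 1 := by
    rw [dotProduct_comm]; exact planarXString_dotProduct_planarZString k
  rw [dotProduct_add, h2] at h1
  have key : ∀ t : ZMod 2, t + 1 = 0 → t = 1 := by decide
  exact key _ h1

/-- **Failure ⇒ odd-crossing residual** (code capacity): if a minimum-weight decoder `D` of the `H_X`-sector fails on `e`,
the residual `D(H_X e) + e` crosses the bottom rough boundary an odd number of times.
[cite: DennisEtAl2002, §4.3 (success iff E + E' is homologically trivial)] -/
theorem planar_oddResidual_of_not_corrects (k : ℕ) {D : Decoder (PlanarCheck k → ZMod 2) (PlanarQubit k → ZMod 2)}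
    (hD : D.IsMinWeight (fun e => planarHX k *ᵥ e) {x | planarHX k *ᵥ x = 0} hammingNorm)
    {e : PlanarQubit k → ZMod 2}
    (hfail : ¬ D.Corrects (fun e => planarHX k *ᵥ e) (planarSZ k : Set (PlanarQubit k → ZMod 2)) e) :
    ∑ b : Fin (k + 2), (D (planarHX k *ᵥ e) + e) (Sum.inl (0, b)) = 1 :=
  planar_bottomCrossing_eq_one k (hD.add_mem e) hfail

open Classical in
/-- The failure probability is at most the probability of an odd-crossing residual.
[cite: DennisEtAl2002, §5.2 (Prob_fail ≤ the probability of a non-trivial (relative) polygon)] -/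
theorem planarFailureFamily_le_sum_oddResidual (D : ∀ k, Decoder (PlanarCheck k → ZMod 2) (PlanarQubit k → ZMod 2))
    (hD : ∀ k, (D k).IsMinWeight (fun e => planarHX k *ᵥ e) {x | planarHX k *ᵥ x = 0} hammingNorm) (k : ℕ) {p : ℝ}
    (hp0 : 0 ≤ p) (hp1 : p ≤ 1) :
    planarFailureFamily D k p ≤ ∑ e ∈ univ.filter (fun e : PlanarQubit k → ZMod 2 =>
      ∑ b : Fin (k + 2), (D k (planarHX k *ᵥ e) + e) (Sum.inl (0, b)) = 1), bernoulliWeight p (supp e) := by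
  refine Finset.sum_le_sum_of_subset_of_nonneg (fun e he => ?_) fun e _ _ => bernoulliWeight_nonneg hp0 hp1 _
  rw [Finset.mem_filter] at he ⊢
  exact ⟨Finset.mem_univ _, planar_oddResidual_of_not_corrects k (hD k) he.2⟩

/-- ★ **DKLP's finite-size bound for the planar surface code, proved**: under `cₙ ≤ C νⁿ` (`ν > 0`), for every
minimum-weight decoder family of the `H_X`-sector and every `0 ≤ p ≤ 1/2` with `r = 2ν√(p(1-p)) < 1`,
`P_fail(k, p) ≤ (k+2)·C·r^{k+2}/(1-r)` (relative form of eq. (fail_2d), our constants).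
[cite: DennisEtAl2002, §5.3 eq. (fail_2d) (relative polygons: "no effect on the estimate of the threshold")] -/
theorem planarFailureFamily_le_of_sawCountBound {C ν : ℝ} (hν : 0 < ν) (hC : SAWCountBound C ν)
    (D : ∀ k, Decoder (PlanarCheck k → ZMod 2) (PlanarQubit k → ZMod 2))
    (hD : ∀ k, (D k).IsMinWeight (fun e => planarHX k *ᵥ e) {x | planarHX k *ᵥ x = 0} hammingNorm) (k : ℕ) {p : ℝ}
    (hp0 : 0 ≤ p) (hp : p ≤ 1 / 2) (hr1 : 2 * ν * Real.sqrt (p * (1 - p)) < 1) :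
    planarFailureFamily D k p ≤
      ((k : ℝ) + 2) * C * (2 * ν * Real.sqrt (p * (1 - p))) ^ (k + 2) / (1 - 2 * ν * Real.sqrt (p * (1 - p))) :=
  (planarFailureFamily_le_sum_oddResidual D hD k hp0 (by linarith)).trans
    (sum_bernoulliWeight_oddResidual_le hν hC (hD k) hp0 hp hr1)

/-- **Below threshold for `4ν² p(1-p) < 1`** (given `cₙ ≤ C νⁿ`, `ν > 0`): the planar failure probability tends to `0` along
the family, for every minimum-weight decoder family of the `H_X`-sector.
[cite: DennisEtAl2002, §5.3 eq. (threshold_2d)] -/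
theorem planar_belowThreshold_of_sawCountBound {C ν : ℝ} (hν : 0 < ν) (hC : SAWCountBound C ν)
    (D : ∀ k, Decoder (PlanarCheck k → ZMod 2) (PlanarQubit k → ZMod 2))
    (hD : ∀ k, (D k).IsMinWeight (fun e => planarHX k *ᵥ e) {x | planarHX k *ᵥ x = 0} hammingNorm) {p : ℝ}
    (hp0 : 0 ≤ p) (hp : p ≤ 1 / 2) (h4 : 4 * ν ^ 2 * (p * (1 - p)) < 1) :
    BelowThreshold (planarFailureFamily D) p := by
  have ht := tendsto_sum_oddResidual hν hC D hD hp0 hp h4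
  refine squeeze_zero' (Filter.Eventually.of_forall fun k => ?_)
    (Filter.Eventually.of_forall fun k => planarFailureFamily_le_sum_oddResidual D hD k hp0 (by linarith)) ht
  exact Finset.sum_nonneg fun e _ => bernoulliWeight_nonneg hp0 (by linarith) _

/-! ### From walk counts / the connective constant to `p₀` — a generic lemma, then the planar instances -/

/-- **GENERIC `p₀(μ')` lemma** (any family of failure probabilities `P`): if `P` is below threshold at every
`0 ≤ p ≤ 1/2` with `4ν² p(1-p) < 1`, for EVERY `ν > μ'` (`μ' ≥ 1`), then `p₀(μ') = (1 - √(1 - μ'⁻²))/2` is a threshold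
lower bound of `P` (for `p < p₀(μ')` one has `4μ'² p(1-p) < 1`, so some `ν` strictly above `μ'` still works). The toric
instance is `isThresholdLowerBound_of_forall_gt`. [cite: DennisEtAl2002, §5.3 eqs. (threshold_2d)–(p_c_2d)] -/
theorem isThresholdLowerBound_thresholdValue_of_forall_gt {P : ℕ → ℝ → ℝ} {μ' : ℝ} (hμ' : 1 ≤ μ')
    (h : ∀ ν : ℝ, μ' < ν → ∀ p : ℝ, 0 ≤ p → p ≤ 1 / 2 → 4 * ν ^ 2 * (p * (1 - p)) < 1 → BelowThreshold P p) :
    IsThresholdLowerBound P (thresholdValue μ') := by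
  intro p hp₀ hpp
  have hp : p ≤ 1 / 2 := hpp.le.trans (thresholdValue_le_half μ')
  have hlt : p * (1 - p) < thresholdValue μ' * (1 - thresholdValue μ') :=
    mul_one_sub_lt_mul_one_sub hpp (by linarith [thresholdValue_le_half μ'])
  have hμ'0 : 0 < μ' := lt_of_lt_of_le one_pos hμ'
  have h4 : 4 * μ' ^ 2 * (p * (1 - p)) < 1 := by
    calc 4 * μ' ^ 2 * (p * (1 - p)) < 4 * μ' ^ 2 * (thresholdValue μ' * (1 - thresholdValue μ')) := by
          gcongr
      _ = 1 := four_mul_sq_mul_thresholdValue hμ'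
  set K : ℝ := 4 * (p * (1 - p)) with hK
  have hK0 : 0 ≤ K := by
    have : 0 ≤ 1 - p := by linarith
    positivity
  obtain ⟨ν, hμν, hνK⟩ : ∃ ν : ℝ, μ' < ν ∧ 4 * ν ^ 2 * (p * (1 - p)) < 1 := by
    rcases hK0.eq_or_lt with hK00 | hKpos
    · refine ⟨μ' + 1, by linarith, ?_⟩
      have : 4 * (μ' + 1) ^ 2 * (p * (1 - p)) = (μ' + 1) ^ 2 * K := by rw [hK]; ring
      rw [this, ← hK00, mul_zero]
      exact one_pos
    · have hlt' : μ' ^ 2 < 1 / K := by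
        rw [lt_div_iff₀ hKpos]
        calc μ' ^ 2 * K = 4 * μ' ^ 2 * (p * (1 - p)) := by rw [hK]; ring
          _ < 1 := h4
      obtain ⟨t, ht1, ht2⟩ := exists_between hlt'
      have ht0 : 0 < t := lt_of_le_of_lt (sq_nonneg _) ht1
      refine ⟨Real.sqrt t, ?_, ?_⟩
      · calc μ' = Real.sqrt (μ' ^ 2) := (Real.sqrt_sq hμ'0.le).symm
          _ < Real.sqrt t := Real.sqrt_lt_sqrt (sq_nonneg _) ht1
      · rw [Real.sq_sqrt ht0.le]
        calc 4 * t * (p * (1 - p)) = t * K := by rw [hK]; ring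
          _ < 1 / K * K := by gcongr
          _ = 1 := by field_simp
  exact h ν hμν p hp₀ hp hνK

/-- **Planar threshold `≥ p₀(ν)` from a walk-count bound `cₙ ≤ C νⁿ`** (`ν ≥ 1`), for every minimum-weight decoder family
of the `H_X`-sector. [cite: DennisEtAl2002, §5.3 eqs. (threshold_2d)–(p_c_2d)] -/
theorem planar_isThresholdLowerBound_of_sawCountBound {C ν : ℝ} (hν : 1 ≤ ν) (hC : SAWCountBound C ν)
    (D : ∀ k, Decoder (PlanarCheck k → ZMod 2) (PlanarQubit k → ZMod 2))
    (hD : ∀ k, (D k).IsMinWeight (fun e => planarHX k *ᵥ e) {x | planarHX k *ᵥ x = 0} hammingNorm) :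
    IsThresholdLowerBound (planarFailureFamily D) (thresholdValue ν) := by
  intro p hp₀ hpp
  have hp : p ≤ 1 / 2 := hpp.le.trans (thresholdValue_le_half ν)
  have hlt : p * (1 - p) < thresholdValue ν * (1 - thresholdValue ν) :=
    mul_one_sub_lt_mul_one_sub hpp (by linarith [thresholdValue_le_half ν])
  have hν0 : 0 < ν := lt_of_lt_of_le one_pos hν
  have h4 : 4 * ν ^ 2 * (p * (1 - p)) < 1 := by
    calc 4 * ν ^ 2 * (p * (1 - p)) < 4 * ν ^ 2 * (thresholdValue ν * (1 - thresholdValue ν)) := by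
          gcongr
      _ = 1 := four_mul_sq_mul_thresholdValue hν
  exact planar_belowThreshold_of_sawCountBound hν0 hC D hD hp₀ hp h4

/-- **Planar threshold from any bound on the connective constant** (tier = the tier of that bound): if `μ(ℤ²) ≤ μ'` with
`μ' ≥ 1`, then `p₀(μ')` is a threshold lower bound for every minimum-weight decoder family of the `H_X`-sector
(`cₙ^{1/n} → μ` gives `cₙ ≤ C νⁿ` for every `ν > μ'`). [cite: DennisEtAl2002, §5.3 eqs. (saw_2), (threshold_2d)] -/
theorem planar_isThresholdLowerBound_of_connectiveConstant_le {μ' : ℝ} (hμ'1 : 1 ≤ μ')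
    (hμ : SAW.Zd.connectiveConstant 2 ≤ μ') (D : ∀ k, Decoder (PlanarCheck k → ZMod 2) (PlanarQubit k → ZMod 2))
    (hD : ∀ k, (D k).IsMinWeight (fun e => planarHX k *ᵥ e) {x | planarHX k *ᵥ x = 0} hammingNorm) :
    IsThresholdLowerBound (planarFailureFamily D) (thresholdValue μ') := by
  refine isThresholdLowerBound_thresholdValue_of_forall_gt hμ'1 fun ν hν p hp0 hp h4 => ?_
  obtain ⟨C, hC⟩ := exists_sawCountBound_of_connectiveConstant_lt (lt_of_le_of_lt hμ hν)
  exact planar_belowThreshold_of_sawCountBound (by linarith) hC D hD hp0 hp h4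

/-! ### The kernel certificate `μ(ℤ²) ≤ 2.6939`: `p_c(planar) > .0357` -/

/-- ★ **Planar-surface-code threshold `≥ p₀(2.6939)`, UNCONDITIONAL, tier CERTIFIED (kernel)**, for every minimum-weight
decoder family of the `H_X`-sector (code capacity), from the kernel-checked symmetry-reduced memory-16 bound
`μ(ℤ²) ≤ 2.6939`. [cite: DennisEtAl2002, §5.3 eqs. (saw_2), (threshold_2d)] [cite: PonitzTittmann2000, Table 2 (d = 2, k = 16)] -/
theorem planar_isThresholdLowerBound_kernelSymmK16 (D : ∀ k, Decoder (PlanarCheck k → ZMod 2) (PlanarQubit k → ZMod 2))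
    (hD : ∀ k, (D k).IsMinWeight (fun e => planarHX k *ᵥ e) {x | planarHX k *ᵥ x = 0} hammingNorm) :
    IsThresholdLowerBound (planarFailureFamily D) (thresholdValue 2.6939) :=
  planar_isThresholdLowerBound_of_connectiveConstant_le (by norm_num) SAW.Zd.connectiveConstant_two_le_26939 D hD

/-- Decimal form: **every `0 ≤ p < .0357` is below threshold** for every minimum-weight decoder family of the planar
`H_X`-sector — UNCONDITIONAL, tier CERTIFIED (kernel). [cite: DennisEtAl2002, §4.3 and §5.3 eq. (threshold_2d)] -/
theorem planar_isThresholdLowerBound_0357 (D : ∀ k, Decoder (PlanarCheck k → ZMod 2) (PlanarQubit k → ZMod 2))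
    (hD : ∀ k, (D k).IsMinWeight (fun e => planarHX k *ᵥ e) {x | planarHX k *ᵥ x = 0} hammingNorm) :
    IsThresholdLowerBound (planarFailureFamily D) 0.0357 :=
  (planar_isThresholdLowerBound_kernelSymmK16 D hD).anti thresholdValue_26939_bounds.1.le

/-- ★ **`p_c(planar) > .0357`** for every minimum-weight decoder family of the `H_X`-sector (code capacity) — UNCONDITIONAL,
tier CERTIFIED (kernel); was `.0285` (`planar_accuracyThreshold_gt`, cluster expansion). The printed `.0373` (DKLP, numerical
`μ₂`) and the numerical MWPM value `.1031` (Wang–Harrington–Preskill) are CLAIMS, not asserted.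
[cite: DennisEtAl2002, §5.3 eq. (p_c_2d)] [cite: WangHarringtonPreskill2003, abstract (p_c0 = .1031 ± .0001, numerical)] -/
theorem planar_accuracyThreshold_gt_0357 (D : ∀ k, Decoder (PlanarCheck k → ZMod 2) (PlanarQubit k → ZMod 2))
    (hD : ∀ k, (D k).IsMinWeight (fun e => planarHX k *ᵥ e) {x | planarHX k *ᵥ x = 0} hammingNorm) :
    (0.0357 : ℝ) < accuracyThreshold (planarFailureFamily D) :=
  lt_of_lt_of_le thresholdValue_26939_bounds.1
    (le_accuracyThreshold (planar_isThresholdLowerBound_kernelSymmK16 D hD)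
      ((thresholdValue_le_half _).trans (by norm_num)))

/-- The canonical instance: MINIMUM-WEIGHT DECODING of the planar surface codes has `p_c > .0357` (code capacity,
`H_X`-sector) — UNCONDITIONAL, tier CERTIFIED (kernel). [cite: DennisEtAl2002, §5.1 (the minimum-weight chain E_min) and §5.3] -/
theorem planar_accuracyThreshold_minWeight_gt_0357 :
    (0.0357 : ℝ) < accuracyThreshold
      (planarFailureFamily fun k => Decoder.minWeight (fun e : PlanarQubit k → ZMod 2 => planarHX k *ᵥ e) hammingNorm) :=
  planar_accuracyThreshold_gt_0357 _ planar_isMinWeight_minWeight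

/-- **Exponential decay below `p₀(ν)`** (given `cₙ ≤ C νⁿ`, `ν ≥ 1`): for every minimum-weight decoder family of the planar
`H_X`-sector and every `0 ≤ p < p₀(ν)`, `P_fail(k) ≤ C' r'^k` for some `C'`, `r' < 1` (from
`(k+2)·C·r^{k+2}/(1-r) ≤ (2C r²/(1-r))·(k+1)·r^k`). [cite: DennisEtAl2002, §5.3 eq. (fail_2d)] -/
theorem planar_decaysExponentially_of_sawCountBound {C ν : ℝ} (hν : 1 ≤ ν) (hC : SAWCountBound C ν)
    (D : ∀ k, Decoder (PlanarCheck k → ZMod 2) (PlanarQubit k → ZMod 2))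
    (hD : ∀ k, (D k).IsMinWeight (fun e => planarHX k *ᵥ e) {x | planarHX k *ᵥ x = 0} hammingNorm) {p : ℝ}
    (hp₀ : 0 ≤ p) (hpp : p < thresholdValue ν) : DecaysExponentially (planarFailureFamily D) p := by
  have hp : p ≤ 1 / 2 := hpp.le.trans (thresholdValue_le_half ν)
  have hlt : p * (1 - p) < thresholdValue ν * (1 - thresholdValue ν) :=
    mul_one_sub_lt_mul_one_sub hpp (by linarith [thresholdValue_le_half ν])
  have hν0 : 0 < ν := lt_of_lt_of_le one_pos hν
  have h4 : 4 * ν ^ 2 * (p * (1 - p)) < 1 := by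
    calc 4 * ν ^ 2 * (p * (1 - p)) < 4 * ν ^ 2 * (thresholdValue ν * (1 - thresholdValue ν)) := by
          gcongr
      _ = 1 := four_mul_sq_mul_thresholdValue hν
  set s := Real.sqrt (p * (1 - p)) with hs
  set r := 2 * ν * s with hr
  have hpp' : 0 ≤ p * (1 - p) := mul_nonneg hp₀ (by linarith)
  have hr0 : 0 ≤ r := by rw [hr]; positivity
  have hr1 : r < 1 := by
    have hsq : r ^ 2 = 4 * ν ^ 2 * (p * (1 - p)) := by
      rw [hr, mul_pow, mul_pow, hs, Real.sq_sqrt hpp']; ring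
    have h' : r ^ 2 < 1 := by rw [hsq]; exact h4
    have := (sq_lt_one_iff_abs_lt_one r).1 h'
    rwa [abs_of_nonneg hr0] at this
  have h1r : 0 < 1 - r := by linarith
  have hC0 : 0 ≤ C := by
    have h0 := hC 0
    rw [SAW.count_zero, pow_zero, mul_one, Nat.cast_one] at h0
    linarith
  refine decaysExponentially_of_eventually_abs_le (A := 2 * C * r ^ 2 / (1 - r)) (k := 1) hr0 hr1 ?_
  refine Filter.Eventually.of_forall fun k => ?_
  have hnonneg : 0 ≤ planarFailureFamily D k p :=
    Finset.sum_nonneg fun e _ => bernoulliWeight_nonneg hp₀ (by linarith) _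
  rw [abs_of_nonneg hnonneg]
  have hb := planarFailureFamily_le_of_sawCountBound hν0 hC D hD k hp₀ hp hr1
  have hk2 : (k : ℝ) + 2 ≤ 2 * ((k : ℝ) + 1) := by linarith [(Nat.cast_nonneg k : (0 : ℝ) ≤ k)]
  calc planarFailureFamily D k p ≤ ((k : ℝ) + 2) * C * r ^ (k + 2) / (1 - r) := hb
    _ = ((k : ℝ) + 2) * (C * r ^ 2 / (1 - r) * r ^ k) := by rw [pow_add]; field_simp
    _ ≤ 2 * ((k : ℝ) + 1) * (C * r ^ 2 / (1 - r) * r ^ k) :=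
        mul_le_mul_of_nonneg_right hk2 (by positivity)
    _ = 2 * C * r ^ 2 / (1 - r) * ((k : ℝ) + 1) ^ 1 * r ^ k := by rw [pow_one]; field_simp

/-- **Exponential decay at every `0 ≤ p ≤ .0357`** (planar `H_X`-sector, every minimum-weight decoder family) — UNCONDITIONAL,
tier CERTIFIED (kernel) (walk-count constant at `ν = 2.694 > μ(ℤ²)`; `.0357 < p₀(2.694)`). [cite: DennisEtAl2002, §5.3 eq. (fail_2d)] -/
theorem planar_decaysExponentially_0357 (D : ∀ k, Decoder (PlanarCheck k → ZMod 2) (PlanarQubit k → ZMod 2))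
    (hD : ∀ k, (D k).IsMinWeight (fun e => planarHX k *ᵥ e) {x | planarHX k *ᵥ x = 0} hammingNorm) {p : ℝ}
    (hp₀ : 0 ≤ p) (hpp : p ≤ 0.0357) : DecaysExponentially (planarFailureFamily D) p := by
  have hlt : SAW.Zd.connectiveConstant 2 < 2.694 :=
    lt_of_le_of_lt SAW.Zd.connectiveConstant_two_le_26939 (by norm_num)
  obtain ⟨C, hC⟩ := exists_sawCountBound_of_connectiveConstant_lt hlt
  have hval : (0.0357 : ℝ) < thresholdValue 2.694 := by
    unfold thresholdValue
    have : Real.sqrt (1 - 1 / (2.694 : ℝ) ^ 2) < 0.9286 := by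
      rw [Real.sqrt_lt' (by norm_num)]
      norm_num
    linarith
  exact planar_decaysExponentially_of_sawCountBound (by norm_num) hC D hD hp₀ (lt_of_le_of_lt hpp hval)

/-! ### Minimum-weight perfect matching with the rough edge as boundary -/

/-- ★ **Planar threshold `≥ p₀(2.6939)` for EVERY boundary-MWPM decoder family** of the `H_X`-sector (any presentation `ι`
of `planarHX k` as graphlike-with-boundary, any link metric, tie-break, geodesics: matching decoders are minimum-weight,
`isMinWeight_boundaryDecoder`) — UNCONDITIONAL, tier CERTIFIED (kernel).
[cite: DennisEtAl2002, §5.1 (E_min by Edmonds' matching) and §5.3 eq. (threshold_2d)] -/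
theorem planar_mwpm_isThresholdLowerBound_kernelSymmK16 {ι : ∀ k, PlanarQubit k → Sym2 (Option (PlanarCheck k))}
    (hι : ∀ k, IsGraphlikeVia (planarHX k) (ι k)) (m : ∀ k, EdgeMetric (ι k))
    {D' : ∀ k, Decoder (Option (PlanarCheck k) → ZMod 2) (PlanarQubit k → ZMod 2)}
    (hD : ∀ k, IsMatchingDecoder (m k) (D' k)) :
    IsThresholdLowerBound (planarFailureFamily fun k => boundaryDecoder (D' k)) (thresholdValue 2.6939) :=
  planar_isThresholdLowerBound_kernelSymmK16 _ fun k => isMinWeight_boundaryDecoder (hι k) (hD k)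

/-- **`p_c^{MWPM}(planar) > .0357`** (code capacity, `H_X`-sector), every boundary-MWPM family — UNCONDITIONAL, tier
CERTIFIED (kernel); was `.0285`. The numerical value `.1031` (Wang–Harrington–Preskill) is a CLAIM, not asserted.
[cite: DennisEtAl2002, §5.3 eq. (p_c_2d)] [cite: WangHarringtonPreskill2003, abstract (p_c0 = .1031 ± .0001, numerical)] -/
theorem planar_mwpm_accuracyThreshold_gt_0357 {ι : ∀ k, PlanarQubit k → Sym2 (Option (PlanarCheck k))}
    (hι : ∀ k, IsGraphlikeVia (planarHX k) (ι k)) (m : ∀ k, EdgeMetric (ι k))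
    {D' : ∀ k, Decoder (Option (PlanarCheck k) → ZMod 2) (PlanarQubit k → ZMod 2)}
    (hD : ∀ k, IsMatchingDecoder (m k) (D' k)) :
    (0.0357 : ℝ) < accuracyThreshold (planarFailureFamily fun k => boundaryDecoder (D' k)) :=
  planar_accuracyThreshold_gt_0357 _ fun k => isMinWeight_boundaryDecoder (hι k) (hD k)

/-- **Non-vacuity**: there IS a boundary-MWPM family of the planar `H_X`-sector (some presentation, the extended
shortest-chain metric, some tie-break and geodesics), and its certified threshold exceeds `.0357`.
[cite: DennisEtAl2002, §5.1 and §5.3] -/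
theorem exists_planar_mwpm_family_accuracyThreshold_gt_0357 :
    ∃ (ι : ∀ k, PlanarQubit k → Sym2 (Option (PlanarCheck k)))
      (D' : ∀ k, Decoder (Option (PlanarCheck k) → ZMod 2) (PlanarQubit k → ZMod 2)),
      (∀ k, IsGraphlikeVia (planarHX k) (ι k)) ∧ (∀ k, IsMatchingDecoder (extMetric (ι k)) (D' k)) ∧
        (0.0357 : ℝ) < accuracyThreshold (planarFailureFamily fun k => boundaryDecoder (D' k)) := by
  choose ι hι using exists_isGraphlikeVia_planarHX
  choose D' hD using fun k => exists_isMatchingDecoder_extMetric (ι := ι k)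
  exact ⟨ι, D', hι, hD, planar_mwpm_accuracyThreshold_gt_0357 hι (fun k => extMetric (ι k)) hD⟩

end Summit.Ventures.QEC.Thresholds
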